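import Literature.Analysis.FluidPDE.LerayProfileRegularity
import HarnessLib

/-!
# Route `FilamentSkeletonRss` · crux `TransverseReductionRJ` (stmt-NavierStokesRegularity-21221), line
# `kelvin_gate`, stub S4 `EllipticSmoothing` — helper IIa: weak calculus for `C²` divergence-free
# fields (generic weak pressure–Poisson lemma)

HONEST FRAMING. Bookkeeping for a HYPOTHETICAL filament-type RSS blow-up route; nothing here bears
on Navier–Stokes regularity; no stub is proved in this file.

The S4 system is the ROTATED, FORCED backward profile system on `ℝ³`
`α(e₃ × U − DU[e₃ × y]) + ½U + ½DU[y] − ΔU + DU[U] + ∇P = F`, `div U = 0`, with `U ∈ C²`,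
`P ∈ C¹` and a smooth forcing `F` (the accretion modes). As for Leray's system (Tsai 1998, (2.1);
tree `LerayProfileWeakPressure`) the pressure–Poisson equation holds only weakly at this
regularity. This file (generic part, no route vocabulary) proves, for complex test functions
`ψ ∈ C_c^∞` and `U ∈ C²(ℝ³; ℝ³)` divergence free (the tree's Leray-profile lemmas of
`LerayProfileWeakPressure` with the profile hypothesis replaced by `C² + div U = 0`):

* `sum_integral_laplacian_mul_fderiv_eq_zero` — `Σᵢ ∫ (Σⱼ∂ⱼ∂ⱼUᵢ) ∂ᵢψ = 0`;
* `integral_mul_laplacian_eq_of_gradient` — GENERIC weak pressure–Poisson lemma: if `P ∈ C¹`,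
  `Gᵢ ∈ C¹` and `∂ᵢP = Σⱼ∂ⱼ∂ⱼUᵢ + Gᵢ`, then `∫ P Δψ = ∫ (Σᵢ ∂ᵢGᵢ) ψ`;
* the divergence identities `sum_pderiv_drift_eq_zero`, `sum_pderiv_convect_eq`.

The S4-specific part (rotation pair, the system in coordinates, the weak pressure equation of
S4) is in `FilamentSkeletonRssKelvinGateSmoothingPressure`.

References: T.-P. Tsai, ARMA 143 (1998), (1.3), (2.1); G. B. Folland, *Introduction to PDE*
(1995), §6.A.
-/

set_option linter.dupNamespace false

noncomputable section

namespace Summit.NavierStokesRegularity.NavierStokesRegularity.Theorems.KelvinGate.Smoothing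

open MeasureTheory Set Function
open Literature.Analysis.FluidPDE Literature.Analysis.FunctionSpaces
open scoped ENNReal ContDiff RealInnerProductSpace

/-! ### The viscous term is weakly divergence free (`U ∈ C²`, `div U = 0`) -/

/-- `Σᵢ ∂ᵢ∂ⱼUᵢ = ∂ⱼ(div U) = 0` for `U ∈ C²` divergence free (Schwarz). [cite: Tsai1998, (2.1)] -/
theorem sum_pderiv_pderiv_comp_eq_zero {U : EuclideanSpace ℝ (Fin 3) → EuclideanSpace ℝ (Fin 3)}
    (hU : ContDiff ℝ 2 U) (hdiv : VectorCalculus.IsDivFree U) (j : Fin 3)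
    (x : EuclideanSpace ℝ (Fin 3)) : ∑ i, pderiv i (pderiv j fun z => U z i) x = 0 := by
  have hUc : ∀ i, ContDiff ℝ 2 (fun z => U z i) := fun i => contDiff_comp_euclidean hU i
  have e : ∀ i, pderiv i (pderiv j fun z => U z i) = pderiv j (pderiv i fun z => U z i) :=
    fun i => pderiv_comm_of_contDiff_two (hUc i) i j
  simp_rw [e]
  have hd : ∀ i, Differentiable ℝ (pderiv i fun z => U z i) := fun i =>
    (contDiff_one_pderiv_of_contDiff_two (hUc i) i).differentiable one_ne_zero
  have hs := congrFun (pderiv_sum Finset.univ (f := fun i => pderiv i fun z => U z i)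
    (fun i _ => hd i) j) x
  simp only at hs
  rw [← hs]
  have hz : (fun x => ∑ i, pderiv i (fun z => U z i) x) = fun _ => (0 : ℝ) :=
    funext (hdiv.sum_pderiv_comp_eq_zero (hU.differentiable (by simp)))
  rw [hz, pderiv_const]

/-- **The viscous term is weakly divergence free**: for `U ∈ C²` divergence free and every smooth
compactly supported complex `ψ`, `Σᵢ ∫ (Σⱼ ∂ⱼ∂ⱼUᵢ) ∂ᵢψ = 0` (two integrations by parts and
Schwarz for `ψ`). [cite: Tsai1998, (2.1)] -/
theorem sum_integral_laplacian_mul_fderiv_eq_zero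
    {U : EuclideanSpace ℝ (Fin 3) → EuclideanSpace ℝ (Fin 3)} (hU : ContDiff ℝ 2 U)
    (hdiv : VectorCalculus.IsDivFree U) {ψ : EuclideanSpace ℝ (Fin 3) → ℂ} (hψ : ContDiff ℝ ∞ ψ)
    (hψs : HasCompactSupport ψ) :
    ∑ i, ∫ x, ((∑ j, pderiv j (pderiv j fun z => U z i) x : ℝ) : ℂ) *
      fderiv ℝ ψ x (EuclideanSpace.basisFun (Fin 3) ℝ i) = 0 := by
  set b := EuclideanSpace.basisFun (Fin 3) ℝ with hbdef
  have hUc : ∀ i, ContDiff ℝ 2 (fun z => U z i) := fun i => contDiff_comp_euclidean hU i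
  have hd1 : ∀ i j, ContDiff ℝ 1 (pderiv j fun z => U z i) := fun i j =>
    contDiff_one_pderiv_of_contDiff_two (hUc i) j
  have hdd : ∀ i j, Differentiable ℝ (pderiv j fun z => U z i) := fun i j =>
    (hd1 i j).differentiable one_ne_zero
  have hψ2 : ContDiff ℝ 2 ψ := hψ.of_le (by norm_cast)
  have hDψ : ∀ i, ContDiff ℝ ∞ (fun y => fderiv ℝ ψ y (b i)) := fun i =>
    (hψ.fderiv_right (m := ∞) (by norm_cast)).clm_apply contDiff_const
  have hDψ1 : ∀ i, ContDiff ℝ 1 (fun y => fderiv ℝ ψ y (b i)) := fun i =>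
    (hDψ i).of_le (by exact_mod_cast le_top)
  have hDψs : ∀ i, HasCompactSupport (fun y => fderiv ℝ ψ y (b i)) := fun i =>
    hψs.fderiv_apply (𝕜 := ℝ) (b i)
  have hij : ∀ i j, ∫ x, (pderiv j (pderiv j fun z => U z i) x : ℂ) * fderiv ℝ ψ x (b i) =
      -∫ x, (pderiv j (fun z => U z i) x : ℂ) *
        fderiv ℝ (fun y => fderiv ℝ ψ y (b j)) x (b i) := by
    intro i j
    have hibp := Literature.Analysis.FunctionSpaces.integral_mul_fderiv_apply_eq_neg
      (contDiff_ofReal_comp (hd1 i j)) (hDψ1 i) (hDψs i) (b j)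
    have e1 : ∀ x, fderiv ℝ (fun y => (pderiv j (fun z => U z i) y : ℂ)) x (b j) =
        (pderiv j (pderiv j fun z => U z i) x : ℂ) := fun x => by
      have := congrFun (fderiv_ofReal_comp_stdVec (hdd i j) j) x
      simpa only [hbdef] using this
    have hsym : ∀ x, fderiv ℝ (fun y => fderiv ℝ ψ y (b i)) x (b j) =
        fderiv ℝ (fun y => fderiv ℝ ψ y (b j)) x (b i) := fun x =>
      fderiv_fderiv_comm_of_contDiff_two hψ2 (b i) (b j) x
    simp_rw [hsym] at hibp
    rw [hibp, neg_neg]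
    refine integral_congr_ae (Filter.Eventually.of_forall fun x => ?_)
    simp only [e1]
  have hI : ∀ i j, Integrable (fun x => (pderiv j (pderiv j fun z => U z i) x : ℂ) *
      fderiv ℝ ψ x (b i)) (volume : Measure (EuclideanSpace ℝ (Fin 3))) := fun i j =>
    integrable_ofReal_mul (continuous_pderiv (hd1 i j) one_ne_zero j) (hDψ i).continuous (hDψs i)
  have hsplit : ∀ i, ∫ x, ((∑ j, pderiv j (pderiv j fun z => U z i) x : ℝ) : ℂ) *
      fderiv ℝ ψ x (b i) = ∑ j, ∫ x, (pderiv j (pderiv j fun z => U z i) x : ℂ) *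
        fderiv ℝ ψ x (b i) := by
    intro i
    rw [← integral_finsetSum _ fun j _ => hI i j]
    refine integral_congr_ae (Filter.Eventually.of_forall fun x => ?_)
    push_cast
    rw [Finset.sum_mul]
  simp_rw [hsplit, hij]
  rw [Finset.sum_comm]
  refine Finset.sum_eq_zero fun j _ => ?_
  rw [Finset.sum_neg_distrib, sum_integral_ofReal_mul_fderiv_eq (fun i => hd1 i j) (hDψ1 j) (hDψs j)]
  simp [sum_pderiv_pderiv_comp_eq_zero hU hdiv j]

/-! ### The generic weak pressure equation -/

/-- **Weak pressure–Poisson equation, generic form.** Let `U ∈ C²(ℝ³; ℝ³)` be divergence free,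
`P ∈ C¹`, `Gᵢ ∈ C¹`, and suppose `∂ᵢP = Σⱼ∂ⱼ∂ⱼUᵢ + Gᵢ` pointwise (the momentum equation solved for
the pressure gradient). Then for every smooth compactly supported complex `ψ`,
`∫ P Σᵢ∂ᵢ∂ᵢψ = ∫ (Σᵢ ∂ᵢGᵢ) ψ`: `ΔP = div G` in the sense of distributions (the viscous term drops
out by `sum_integral_laplacian_mul_fderiv_eq_zero`). [cite: Tsai1998, (2.1)] -/
theorem integral_mul_laplacian_eq_of_gradient
    {U : EuclideanSpace ℝ (Fin 3) → EuclideanSpace ℝ (Fin 3)} {P : EuclideanSpace ℝ (Fin 3) → ℝ}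
    {G : Fin 3 → EuclideanSpace ℝ (Fin 3) → ℝ} (hU : ContDiff ℝ 2 U)
    (hdiv : VectorCalculus.IsDivFree U) (hP : ContDiff ℝ 1 P) (hG : ∀ i, ContDiff ℝ 1 (G i))
    (hgrad : ∀ i x, pderiv i P x = (∑ j, pderiv j (pderiv j fun z => U z i) x) + G i x)
    (ψ : EuclideanSpace ℝ (Fin 3) → ℂ) (hψ : ContDiff ℝ ∞ ψ) (hψs : HasCompactSupport ψ) :
    ∫ x, (P x : ℂ) * ∑ i, fderiv ℝ (fun y => fderiv ℝ ψ y (EuclideanSpace.basisFun (Fin 3) ℝ i)) x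
        (EuclideanSpace.basisFun (Fin 3) ℝ i) =
      ∫ x, ((∑ i, pderiv i (G i) x : ℝ) : ℂ) * ψ x := by
  set b := EuclideanSpace.basisFun (Fin 3) ℝ with hbdef
  have hUc : ∀ i, ContDiff ℝ 2 (fun z => U z i) := fun i => contDiff_comp_euclidean hU i
  have hd1 : ∀ i j, ContDiff ℝ 1 (pderiv j fun z => U z i) := fun i j =>
    contDiff_one_pderiv_of_contDiff_two (hUc i) j
  have hPd : Differentiable ℝ P := hP.differentiable one_ne_zero
  have hDψ : ∀ i, ContDiff ℝ ∞ (fun y => fderiv ℝ ψ y (b i)) := fun i =>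
    (hψ.fderiv_right (m := ∞) (by norm_cast)).clm_apply contDiff_const
  have hDψ1 : ∀ i, ContDiff ℝ 1 (fun y => fderiv ℝ ψ y (b i)) := fun i =>
    (hDψ i).of_le (by exact_mod_cast le_top)
  have hDψs : ∀ i, HasCompactSupport (fun y => fderiv ℝ ψ y (b i)) := fun i =>
    hψs.fderiv_apply (𝕜 := ℝ) (b i)
  have hψ1 : ContDiff ℝ 1 ψ := hψ.of_le (by exact_mod_cast le_top)
  set L : Fin 3 → EuclideanSpace ℝ (Fin 3) → ℝ :=
    fun i x => ∑ j, pderiv j (pderiv j fun z => U z i) x with hLdef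
  have hLc : ∀ i, Continuous (L i) := fun i =>
    continuous_finsetSum _ fun j _ => continuous_pderiv (hd1 i j) one_ne_zero j
  -- Step 1: move one derivative onto `P`
  have hstep1 : ∫ x, (P x : ℂ) * ∑ i, fderiv ℝ (fun y => fderiv ℝ ψ y (b i)) x (b i) =
      -∑ i, ∫ x, (pderiv i P x : ℂ) * fderiv ℝ ψ x (b i) := by
    have hI : ∀ i, Integrable (fun x => (P x : ℂ) * fderiv ℝ (fun y => fderiv ℝ ψ y (b i)) x (b i))
        (volume : Measure (EuclideanSpace ℝ (Fin 3))) := fun i =>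
      integrable_ofReal_mul hP.continuous (((hDψ i).fderiv_right (m := ∞)
        (by norm_cast)).clm_apply contDiff_const).continuous ((hDψs i).fderiv_apply (𝕜 := ℝ) (b i))
    simp_rw [Finset.mul_sum]
    rw [integral_finsetSum _ fun i _ => hI i, ← Finset.sum_neg_distrib]
    refine Finset.sum_congr rfl fun i _ => ?_
    rw [Literature.Analysis.FunctionSpaces.integral_mul_fderiv_apply_eq_neg (contDiff_ofReal_comp hP)
      (hDψ1 i) (hDψs i) (b i)]
    congr 1
    refine integral_congr_ae (Filter.Eventually.of_forall fun x => ?_)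
    have e := congrFun (fderiv_ofReal_comp_stdVec hPd i) x
    simp only [← hbdef] at e
    simp only [e]
  -- Step 2: split `∂ᵢP = Lᵢ + Gᵢ`
  have hIL : ∀ i, Integrable (fun x => (L i x : ℂ) * fderiv ℝ ψ x (b i))
      (volume : Measure (EuclideanSpace ℝ (Fin 3))) :=
    fun i => integrable_ofReal_mul (hLc i) (hDψ i).continuous (hDψs i)
  have hIG : ∀ i, Integrable (fun x => (G i x : ℂ) * fderiv ℝ ψ x (b i))
      (volume : Measure (EuclideanSpace ℝ (Fin 3))) :=
    fun i => integrable_ofReal_mul (hG i).continuous (hDψ i).continuous (hDψs i)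
  have hstep2 : ∀ i, ∫ x, (pderiv i P x : ℂ) * fderiv ℝ ψ x (b i) =
      (∫ x, (L i x : ℂ) * fderiv ℝ ψ x (b i)) + ∫ x, (G i x : ℂ) * fderiv ℝ ψ x (b i) := by
    intro i
    rw [← integral_add (hIL i) (hIG i)]
    refine integral_congr_ae (Filter.Eventually.of_forall fun x => ?_)
    beta_reduce
    rw [hgrad i x]
    simp only [hLdef]
    push_cast
    ring
  -- Step 3: the two sums
  have hT1 : ∑ i, ∫ x, (L i x : ℂ) * fderiv ℝ ψ x (b i) = 0 :=
    sum_integral_laplacian_mul_fderiv_eq_zero hU hdiv hψ hψs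
  have hT2 : ∑ i, ∫ x, (G i x : ℂ) * fderiv ℝ ψ x (b i) =
      -∫ x, ((∑ i, pderiv i (G i) x : ℝ) : ℂ) * ψ x :=
    sum_integral_ofReal_mul_fderiv_eq hG hψ1 hψs
  rw [hstep1]
  simp_rw [hstep2]
  rw [Finset.sum_add_distrib, hT1, hT2, zero_add, neg_neg]

/-! ### Divergence identities for `C²` divergence-free fields -/

/-- `div ((y·∇)U) = div U + (y·∇) div U = 0`. [cite: Tsai1998, (2.1)] -/
theorem sum_pderiv_drift_eq_zero {U : EuclideanSpace ℝ (Fin 3) → EuclideanSpace ℝ (Fin 3)}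
    (hU : ContDiff ℝ 2 U) (hdiv : VectorCalculus.IsDivFree U) (x : EuclideanSpace ℝ (Fin 3)) :
    ∑ i, pderiv i (fun y => ∑ j, y j * pderiv j (fun z => U z i) y) x = 0 := by
  have hUc : ∀ i, ContDiff ℝ 2 (fun z => U z i) := fun i => contDiff_comp_euclidean hU i
  have hd : ∀ i j, Differentiable ℝ (pderiv j fun z => U z i) := fun i j =>
    (contDiff_one_pderiv_of_contDiff_two (hUc i) j).differentiable one_ne_zero
  have hterm : ∀ i, pderiv i (fun y => ∑ j, y j * pderiv j (fun z => U z i) y) x =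
      pderiv i (fun z => U z i) x + ∑ j, x j * pderiv i (pderiv j fun z => U z i) x := by
    intro i
    rw [pderiv_sum Finset.univ (f := fun j y => y j * pderiv j (fun z => U z i) y)
      fun j _ => (differentiable_euclideanCoord j).mul (hd i j)]
    have e : ∀ j, pderiv i (fun y => y j * pderiv j (fun z => U z i) y) x =
        (if j = i then 1 else 0) * pderiv j (fun z => U z i) x +
          x j * pderiv i (pderiv j fun z => U z i) x := by
      intro j
      rw [pderiv_mul (differentiable_euclideanCoord j) (hd i j), pderiv_euclideanCoord]
    simp_rw [e, Finset.sum_add_distrib]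
    simp
  simp_rw [hterm, Finset.sum_add_distrib, hdiv.sum_pderiv_comp_eq_zero (hU.differentiable (by simp)) x,
    zero_add]
  rw [Finset.sum_comm]
  simp_rw [← Finset.mul_sum, sum_pderiv_pderiv_comp_eq_zero hU hdiv, mul_zero, Finset.sum_const_zero]

/-- `div ((U·∇)U) = Σᵢⱼ ∂ᵢUⱼ ∂ⱼUᵢ` for `U ∈ C²` divergence free. [cite: Tsai1998, (2.1)] -/
theorem sum_pderiv_convect_eq {U : EuclideanSpace ℝ (Fin 3) → EuclideanSpace ℝ (Fin 3)}
    (hU : ContDiff ℝ 2 U) (hdiv : VectorCalculus.IsDivFree U) (x : EuclideanSpace ℝ (Fin 3)) :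
    ∑ i, pderiv i (fun y => ∑ j, U y j * pderiv j (fun z => U z i) y) x =
      ∑ i, ∑ j, pderiv i (fun z => U z j) x * pderiv j (fun z => U z i) x := by
  have hUc : ∀ i, ContDiff ℝ 2 (fun z => U z i) := fun i => contDiff_comp_euclidean hU i
  have hUd : ∀ i, Differentiable ℝ (fun z => U z i) := fun i => (hUc i).differentiable (by norm_num)
  have hd : ∀ i j, Differentiable ℝ (pderiv j fun z => U z i) := fun i j =>
    (contDiff_one_pderiv_of_contDiff_two (hUc i) j).differentiable one_ne_zero
  have hterm : ∀ i, pderiv i (fun y => ∑ j, U y j * pderiv j (fun z => U z i) y) x =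
      ∑ j, pderiv i (fun z => U z j) x * pderiv j (fun z => U z i) x +
        ∑ j, U x j * pderiv i (pderiv j fun z => U z i) x := by
    intro i
    rw [pderiv_sum Finset.univ (f := fun j y => U y j * pderiv j (fun z => U z i) y)
      fun j _ => (hUd j).mul (hd i j)]
    simp_rw [pderiv_mul (hUd _) (hd i _), Finset.sum_add_distrib]
  simp_rw [hterm, Finset.sum_add_distrib]
  conv_rhs => rw [← add_zero (∑ i, ∑ j, pderiv i (fun z => U z j) x * pderiv j (fun z => U z i) x)]
  congr 1
  rw [Finset.sum_comm]
  simp_rw [← Finset.mul_sum, sum_pderiv_pderiv_comp_eq_zero hU hdiv, mul_zero, Finset.sum_const_zero]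


end Summit.NavierStokesRegularity.NavierStokesRegularity.Theorems.KelvinGate.Smoothing

end
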